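import Summits.BirchSwinnertonDyer.BirchSwinnertonDyer.Theorems.KolyvaginDepthDoorKolyvaginDepthSupplyDoorOfPrint
import Summits.BirchSwinnertonDyer.BirchSwinnertonDyer.Theorems.KolyvaginDepthDoorDepthTableRowKit
import HarnessLib

/-!
# Route `KolyvaginDepthDoor`, crux `KolyvaginDepthSupply` (stmt-BirchSwinnertonDyer-21765) —
# the DEPTH-TABLE ROW KIT WITHOUT KOLYVAGIN'S STRUCTURE THEOREM

Helper file (`--supports stmt-BirchSwinnertonDyer-21765 --as helper`); it closes nothing and BSD is
not proved by it.

`…DepthTableRowKit.depthRow_of_intModel_certificate` (the generic row of the route's depth table: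
every side condition read off an integer model `E₀` of `W`) is CONDITIONAL on
`hF = Kolyvagin1991_selmerCorank_of_kolyvaginClass_ne_zero` (Kolyvagin 1991 Thm. 4, XL). This file
is the same generic row with `hF` replaced by the minimal-depth descent proved in the tree
(`Literature…KolyvaginDescent.HypothesesDepth`, `…DoorOfSystem(Reading)`, `…DoorOfPrint`):

* `depthRow_of_print_of_intModel_certificate` — inputs: the integer-model certificate of the row
  (`K` of discriminant `D ∉ {−3, −4}` with every prime of `Δ(E₀)` split; an odd Kolyvagin prime
  `ℓ` read off the point count `#(E₀ mod ℓ)(𝔽_ℓ)`), `E` non-CM, `p` odd with the `p`-adic tower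
  surjectivity, a COMPATIBLE system `d` of Kolyvagin–Heegner data over a frame `(Dt, β, ι)`, the bit
  `(d ℓ).kolyvaginClass hp 1 ≠ 0`, `2 ≤ rank E(ℚ)`, `1 ≤ rank E^{(D)}(ℚ)`, and the FIVE named
  McCallum facts (`sign_conjAct_kolyvaginClass`, `lemma43_kolyvaginClass_mem_selmerLocalKer`,
  `prop44_localOrder_kolyvaginClass_mul_eq`, `lemma53_selmer_eigen_dependent_at`,
  `prop22_reciprocity_eigen_finset`). Output: `corank_{ℤ_p} Ш(E)[p^∞] = 0`, `rank_ℤ E(ℚ) = 2`,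
  `rank_ℤ E^{(D)}(ℚ) = 1`, `corank_{ℤ_p} Ш(E^{(D)})[p^∞] = 0`.

Differences from the hF-row, honestly: (+) the XL fact is gone; Čebotarev and the descent are
theorems; the trust base is five S/M-sized leaves of Gross/McCallum; NO condition `p ≥ 5`, `p` good,
`p` ordinary or `p ∤ D` is needed by the door itself. (−) The row needs the whole compatible SYSTEM
`d` (Heegner points of all conductors with one system of choices — CM theory, Gross §3 — where the
hF-row takes one datum of conductor `ℓ`), the `p`-adic tower surjectivity (McCallum's image
hypothesis; for `p ≥ 5` a consequence of `ρ̄_{E,p}` onto, or read off the integer model by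
`…OddPrimeKit.hasSurjectiveModNGaloisRep_pow_of_intModel_certificate`), `¬ HasCM`, and ONE rational
point of infinite order on the twist `E^{(D)}` (the hF-row gets `corank Sel_{p^∞}(E^{(D)}) = 1` from
Kolyvagin's exact clause). Per-curve; BSD is not proved by it.

References: [McCallumLMS1991] §§2–5; [GrossLMS1991] §§3–10; [Kolyvagin1991MathAnn] Thm. 2.3;
[WZhang2014] Notations (xii); [JetchevLauterStein2009] §3.6.
-/

set_option linter.dupNamespace false

noncomputable section

open scoped Classical NumberField

namespace Summit.BirchSwinnertonDyer.BirchSwinnertonDyer.Theorems.KolyvaginDepthDoor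

open Literature.NumberTheory.EllipticCurves Literature.NumberTheory.EllipticCurves.ModularForms
  Literature.NumberTheory.EllipticCurves.McCallum1991 WeierstrassCurve NumberField IsDedekindDomain

section Generic

variable {W : WeierstrassCurve ℚ} [W.IsElliptic] [W.IsGloballyMinimal] {E₀ : WeierstrassCurve ℤ}
  (hI : integralModelInt W = E₀)
include hI

/-- **The depth-table row without Kolyvagin's structure theorem, read off an integer model.**
Inputs as in `depthRow_of_intModel_certificate` (globally minimal `W/ℚ` with integral model `E₀`,
`2 ≤ rank_ℤ E(ℚ)`, an imaginary quadratic `K` with `d_K = D ∉ {−3, −4}` in which every prime of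
`Δ(E₀)` splits, an odd prime `ℓ ∤ Δ(E₀) D`, `ℓ ≠ p`, `(D/ℓ) = −1`, `p ∣ ℓ + 1`,
`p ∣ ℓ + 1 − #(E₀ mod ℓ)(𝔽_ℓ)`), but with `hF` REPLACED by: `E` non-CM, `p` odd with `ρ̄_{E,p^n}`
onto for all `n`, a compatible system `d` of Kolyvagin–Heegner data (`hσ`, `hS₁`, `hS₂`, `hemb`),
one point of infinite order on `E^{(D)}` (`1 ≤ rank`), and the five named McCallum facts. OUTPUT from
the bit `(d ℓ).kolyvaginClass hp 1 ≠ 0`: `corank_{ℤ_p} Ш(E/ℚ)[p^∞] = 0`, `rank_ℤ E(ℚ) = 2`,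
`rank_ℤ E^{(D)}(ℚ) = 1`, `corank_{ℤ_p} Ш(E^{(D)}/ℚ)[p^∞] = 0`
(`shaCorank_eq_zero_of_rank_two_of_kolyvaginClass_prime_ne_zero_of_print` with the row kit's
`isKolyvaginPrime_of_intModel_certificate`, `satisfiesHeegnerHypothesis_conductorNorm_of_intModel`).
CONDITIONAL on the five facts; per-curve; BSD is not proved by it.
[cite: Kolyvagin1991MathAnn, Thm. 2.3] [cite: McCallumLMS1991, §§2–5]
[cite: WZhang2014, Notations (xii)] [cite: JetchevLauterStein2009, §3.6 (arXiv:0707.0032)] -/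
theorem depthRow_of_print_of_intModel_certificate
    (h54 : sign_conjAct_kolyvaginClass) (h43 : lemma43_kolyvaginClass_mem_selmerLocalKer)
    (h44 : prop44_localOrder_kolyvaginClass_mul_eq) (h53 : lemma53_selmer_eigen_dependent_at)
    (h22 : prop22_reciprocity_eigen_finset)
    (hcm : ¬ W.HasCM) (hr : 2 ≤ W.mordellWeilRank)
    (p : ℕ) [hp : Fact p.Prime] (hp2 : p ≠ 2)
    (htower : ∀ n : ℕ, W.HasSurjectiveModNGaloisRep (p ^ n : ℕ))
    (K : Type) [Field K] [NumberField K] (hK : IsImaginaryQuadratic K) {D : ℤ}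
    (hD : NumberField.discr K = D) (h3 : D ≠ -3) (h4 : D ≠ -4)
    (hH : ∀ q : ℕ, q.Prime → (q : ℤ) ∣ E₀.Δ → (q = 2 → D % 8 = 1) ∧ (q ≠ 2 → jacobiSym D q = 1))
    (ℓ : ℕ) (hℓ : ℓ.Prime) (hℓ2 : ℓ ≠ 2) (hℓΔ : ¬ (ℓ : ℤ) ∣ E₀.Δ) (hℓD : ¬ (ℓ : ℤ) ∣ D)
    (hℓp : ℓ ≠ p) (hjac : jacobiSym D ℓ = -1) (hℓ1 : p ∣ ℓ + 1) {n : ℕ}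
    (hcard : Nat.card ((E₀.map (Int.castRingHom (ZMod ℓ))).toAffine.Point) = n)
    (haℓ : (p : ℤ) ∣ (ℓ : ℤ) + 1 - n)
    [NeZero (W.conductorNorm ℤ)] (Dt : ModularParametrizationData W (W.conductorNorm ℤ)) (β : ℤ)
    (ι : K →+* ℂ) (d : ∀ m : ℕ, KolyvaginHeegnerData Dt β ι m)
    (hσ : ∀ (m l : ℕ), ∀ l' ∈ m.primeFactors, ∀ (x : ringClassField K ι m)
      (x' : ringClassField K ι (m * l)),
      (x : ℂ) = x' → (((d (m * l)).σ l' x' : ringClassField K ι (m * l)) : ℂ) = ((d m).σ l' x : ℂ))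
    (hS₁ : ∀ (m l : ℕ), ∀ s ∈ (d m).S, ∃ s' ∈ (d (m * l)).S, ∀ (x : ringClassField K ι m)
      (x' : ringClassField K ι (m * l)),
      (x : ℂ) = x' → ((s' x' : ringClassField K ι (m * l)) : ℂ) = (s x : ℂ))
    (hS₂ : ∀ (m l : ℕ), ∀ s' ∈ (d (m * l)).S, ∃ s ∈ (d m).S, ∀ (x : ringClassField K ι m)
      (x' : ringClassField K ι (m * l)),
      (x : ℂ) = x' → ((s' x' : ringClassField K ι (m * l)) : ℂ) = (s x : ℂ))
    (hemb : ∀ (m l : ℕ) (x : ringClassField K ι m) (x' : ringClassField K ι (m * l)),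
      (x : ℂ) = x' → (d (m * l)).emb x' = (d m).emb x)
    (hne : (d ℓ).kolyvaginClass hp.out 1 ≠ 0)
    (htw : 1 ≤ (W.quadraticTwist (D : ℚ)).mordellWeilRank) :
    W.shaCorank p = 0 ∧ W.mordellWeilRank = 2 ∧ (W.quadraticTwist (D : ℚ)).mordellWeilRank = 1 ∧
      (W.quadraticTwist (D : ℚ)).shaCorank p = 0 := by
  obtain ⟨hkol, -⟩ := isKolyvaginPrime_of_intModel_certificate hI p K hK.1 hD ℓ hℓ hℓ2 hℓΔ hℓD
    hℓp hjac hℓ1 hcard haℓ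
  obtain ⟨c, hc, hcc⟩ := exists_conj_of_isImaginaryQuadratic K hK
  have hH' := satisfiesHeegnerHypothesis_conductorNorm_of_intModel hI K hK.1 hD hH
  have h := shaCorank_eq_zero_of_rank_two_of_kolyvaginClass_prime_ne_zero_of_print h54 h43 h44 h53
    h22 hcm hK (by rw [hD]; exact h3) (by rw [hD]; exact h4) hH' p hp2 htower c hc hcc d hσ hS₁ hS₂
    hemb hkol hne hr (by rw [hD]; exact htw)
  rw [hD] at h
  exact h

end Generic

end Summit.BirchSwinnertonDyer.BirchSwinnertonDyer.Theorems.KolyvaginDepthDoor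

end
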